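import Summits.QuantumFields.BalabanUV.T4Continuum.Support.NE7MinimiserC1Lift
import Summits.QuantumFields.BalabanUV.T4Continuum.Support.NE7StabiliserLifting
import HarnessLib

/-!
# NE7MinimiserC1AllData — `U_k(V)` IS `C¹` IN THE DATUM `V` AT EVERY SMALL DATUM, UNCONDITIONALLY (ROAD-G115 §1; ROAD-G114 §11 (ii) «general non-generic data» CLOSED)

For `d = 4`, every `U(n)`, every `L ≥ 2`: `∃ ε₀ > 0, ∀ 0 < ε ≤ ε₀, ∀ N ≥ 1, ∀ j, ∃ δ_V > 0` such that for EVERY unitary `N`-periodic datum `V₀` with `SmallField V₀ δ_V` (reducible, flat,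
pure-gauge, generic alike — NO genericity ∕ stabiliser hypothesis) the `(j+1)`-fold constrained minimisation problem over `V₀` has minimisers, and for EVERY minimiser `U♯` over `V₀` there
is `Ψ : skewSub N → skewSub (L·tower j)`, `C¹` at `0`, `Ψ 0 = 0`, with `chart_{U♯} Ψ(y)` a minimiser over the datum `chart_{V₀} y` for all small `y`; and the constrained minimal action
`y ↦ minAct(chart_{V₀} y)` is `C¹` at `0` (**`minimiser_contDiffAt_allData`**, **`minAct_contDiffAt_allData`**).

MECHANISM.  `NE7MinimiserC1Lift.minimiser_contDiffAt_of_lift` (this gen: the slice∕straightening∕implicit-critical-point chain of ROAD-G114 §9–§10 under the stabiliser-LIFTING hypothesis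
(G3′) «every unitary `N`-periodic `s` with `s·V₀ = V₀` lifts to a unitary `(N·L^{j+1})`-periodic `h` with `h·U♯ = U♯` and corner values `s`») + ✓ p824904
`NE7StabiliserLifting.stabiliser_lifting` (row NE7b gen 158, [NE7bP1-G158-INBOX-2]: Palais' symmetric criticality on the lattice + a symmetric admissible witness + the restricted Lagrange
theorem + H10 `critical_is_minimiser_any_datum` ⇒ (G3′) holds for every minimiser over every `δ_V(ε,n,N,L,j+1)`-small datum) + existence of minimisers (`NE7MinimalOrbitDatumContinuity.thresholds`).

Cell `pub-balaban`, rung (B)+1 sub-cell t4, lineage `b2b-balaban-t4-ne7-p1` (CRUX PROVER NE7 #1 = OWNER of BINDER row NE7), generation 115.  Memo `t4/b2b-balaban-t4-ne7-p1-g115/ROAD-G115.md` §1.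
WHAT ([folklore]; 0 def, 0 sorry; `d = 4`, every `U(n)`, `L ≥ 2`).
HONEST FRAMING (page 1): composition of landed kernel theorems; QUANTIFIERS `∀ j ∃ δ_V` — the datum radius SHRINKS WITH THE LEVEL (it is the minimum of the road's level-uniform radius and
row NE7b's lifting radius, whose symmetric witness is the iterated slab; a `j`-uniform `δ_V` would need a symmetric witness with plaquettes `O(δ_V L^{−2(j+1)})`, not typed); radii∕constants
existential (depend on `V₀`, `N`, `j`); the statement is CENTRED at `V₀` (a `C¹` germ at each small datum, in the exponential chart at `V₀` and the trivial-corner slice gauge through `U♯`),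
not a global `C¹` section; `C¹`, NOT the analyticity [B11] p. 279 asserts; OUR minimisers (B11 (8) with `sfClass`), OUR route, NOT Bałaban's method; nothing of Bałaban's asserted; NOT NE7
as a spine node, NOT NE3; spine 0∕9; finite T⁴ rung (B)+1 — NOT infinite volume, NOT mass gap, NOT BetaPertH, NOT Clay.
-/

set_option autoImplicit false

open scoped BigOperators Matrix Matrix.Norms.L2Operator Topology
open NormedSpace Finset Set Filter Metric

namespace Summit.QuantumFields.BalabanUV.T4Continuum.NE7MinimiserC1AllData

open Literature.MathematicalPhysics.QuantumFieldTheory.Balaban1983to89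
open B7Prop1Explicit B7Prop2Explicit
open T4AveragingDeficitWall (IsUnitaryCfg SmallField)
open T4AveragingDeficitWallBoundary (IsPeriodicCfg)
open AveragingDeficitTorusChart (TDir chart)
open AveragingDeficitTwoLevelPrep (skewSub)
open AveragingDeficitMultiLevelPrep (tower)
open MinimalActionSandwich (IsMinimiser minAct)
open MinimalActionRate (sfClass)
open NE3EnergyShapes (IsUnitarySite IsPeriodicSite)
open NE7MinimalOrbitDatumContinuity (thresholds)
open NE7MinimiserC1Lift (minimiser_contDiffAt_of_lift)
open NE7StabiliserLifting (stabiliser_lifting)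

noncomputable section

variable {n : Type} [Fintype n] [DecidableEq n]

/-- **`U_k(V)` IS `C¹` IN `V` AT EVERY SMALL DATUM, UNCONDITIONALLY** (see the module docstring): for `ε ≤ ε₀`, `N ≥ 1` and every level `j+1` there is `δ_V > 0` such that every unitary
`N`-periodic `δ_V`-small datum `V₀` carries minimisers, and around EVERY minimiser `U♯` over `V₀` there is a local section `y ↦ chart_{U♯} Ψ(y)` of minimisers over `chart_{V₀} y`,
`Ψ` of class `C¹` at `0` with `Ψ 0 = 0`, and `y ↦ minAct(chart_{V₀} y)` is `C¹` at `0`.  No stabiliser ∕ genericity hypothesis. [folklore] -/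
theorem minimiser_contDiffAt_allData [Nonempty n] {L : ℕ} [NeZero L] (hL : 2 ≤ L) :
    ∃ ε₀ : ℝ, 0 < ε₀ ∧ ∀ ε : ℝ, 0 < ε → ε ≤ ε₀ → ∀ (N : ℕ) [NeZero N], 1 ≤ N → ∀ j : ℕ,
      ∃ δV : ℝ, 0 < δV ∧
        ∀ V₀ ∈ {V : Site 4 → Fin 4 → (Matrix n n ℂ)ˣ | IsUnitaryCfg V ∧ IsPeriodicCfg V (N : ℤ) ∧ SmallField V δV},
        (∃ Us : Site 4 → Fin 4 → (Matrix n n ℂ)ˣ, IsMinimiser 4 (sfClass 4 L N ε) L N (j + 1) V₀ Us) ∧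
        ∀ Us : Site 4 → Fin 4 → (Matrix n n ℂ)ˣ, IsMinimiser 4 (sfClass 4 L N ε) L N (j + 1) V₀ Us →
        ∃ Ψ : ↥(skewSub 4 n N) → ↥(skewSub 4 n (L * tower L N j)), ContDiffAt ℝ 1 Ψ 0 ∧ Ψ 0 = 0 ∧
          (∀ᶠ y : ↥(skewSub 4 n N) in 𝓝 0, IsMinimiser 4 (sfClass 4 L N ε) L N (j + 1) (chart (ContinuousLinearMap.id ℝ (Matrix n n ℂ)) N V₀ (y : TDir 4 n N))
            (chart (ContinuousLinearMap.id ℝ (Matrix n n ℂ)) (L * tower L N j) Us ((Ψ y : ↥(skewSub 4 n (L * tower L N j))) : TDir 4 n (L * tower L N j)))) ∧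
          ContDiffAt ℝ 1 (fun y : ↥(skewSub 4 n N) => minAct 4 (sfClass 4 L N ε) L N (j + 1) (chart (ContinuousLinearMap.id ℝ (Matrix n n ℂ)) N V₀ (y : TDir 4 n N))) 0 := by
  obtain ⟨ε₁, hε₁, H⟩ := thresholds (n := n) hL
  obtain ⟨ε₂, hε₂, H2⟩ := minimiser_contDiffAt_of_lift (n := n) hL
  obtain ⟨ε₃, hε₃, H3⟩ := stabiliser_lifting (n := n) hL
  refine ⟨min ε₁ (min ε₂ ε₃), lt_min hε₁ (lt_min hε₂ hε₃), fun ε hε hεle N _ hN j => ?_⟩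
  obtain ⟨-, -, -, H1⟩ := H ε hε (hεle.trans (min_le_left _ _))
  obtain ⟨δ₁, hδ₁, hint₁⟩ := H1 N hN
  obtain ⟨δ₂, hδ₂, hC1⟩ := H2 ε hε (hεle.trans ((min_le_right _ _).trans (min_le_left _ _))) N hN
  obtain ⟨δ₃, hδ₃, hlift⟩ := H3 ε hε (hεle.trans ((min_le_right _ _).trans (min_le_right _ _))) N hN (j + 1)
  refine ⟨min δ₁ (min δ₂ δ₃), lt_min hδ₁ (lt_min hδ₂ hδ₃), fun V₀ hV₀ => ?_⟩
  obtain ⟨hV₀u, hV₀P, hV₀δ⟩ := hV₀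
  have hV₀1 : V₀ ∈ {V : Site 4 → Fin 4 → (Matrix n n ℂ)ˣ | IsUnitaryCfg V ∧ IsPeriodicCfg V (N : ℤ) ∧ SmallField V δ₁} :=
    ⟨hV₀u, hV₀P, MinimalActionRate.SmallField.mono hV₀δ (min_le_left _ _)⟩
  have hV₀2 : V₀ ∈ {V : Site 4 → Fin 4 → (Matrix n n ℂ)ˣ | IsUnitaryCfg V ∧ IsPeriodicCfg V (N : ℤ) ∧ SmallField V δ₂} :=
    ⟨hV₀u, hV₀P, MinimalActionRate.SmallField.mono hV₀δ ((min_le_right _ _).trans (min_le_left _ _))⟩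
  have hV₀3 : V₀ ∈ {V : Site 4 → Fin 4 → (Matrix n n ℂ)ˣ | IsUnitaryCfg V ∧ IsPeriodicCfg V (N : ℤ) ∧ SmallField V δ₃} :=
    ⟨hV₀u, hV₀P, MinimalActionRate.SmallField.mono hV₀δ ((min_le_right _ _).trans (min_le_right _ _))⟩
  refine ⟨?_, fun Us hUs => ?_⟩
  · obtain ⟨U₀, hU₀, -⟩ := hint₁ V₀ hV₀1 (j + 1)
    exact ⟨U₀, hU₀⟩
  · exact hC1 V₀ hV₀2 j Us hUs fun s hsu hsP hsfix => hlift V₀ hV₀3 Us hUs s hsu hsP hsfix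

/-- **THE CONSTRAINED MINIMAL ACTION IS `C¹` AT EVERY SMALL DATUM** (corollary): for `ε ≤ ε₀`, `N ≥ 1`, every level `j+1`: `∃ δ_V > 0` such that for every unitary `N`-periodic
`δ_V`-small `V₀` the map `y ↦ minAct(chart_{V₀} y)` on `skewSub N` is `C¹` at `0`. [folklore] -/
theorem minAct_contDiffAt_allData [Nonempty n] {L : ℕ} [NeZero L] (hL : 2 ≤ L) :
    ∃ ε₀ : ℝ, 0 < ε₀ ∧ ∀ ε : ℝ, 0 < ε → ε ≤ ε₀ → ∀ (N : ℕ) [NeZero N], 1 ≤ N → ∀ j : ℕ,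
      ∃ δV : ℝ, 0 < δV ∧
        ∀ V₀ ∈ {V : Site 4 → Fin 4 → (Matrix n n ℂ)ˣ | IsUnitaryCfg V ∧ IsPeriodicCfg V (N : ℤ) ∧ SmallField V δV},
          ContDiffAt ℝ 1 (fun y : ↥(skewSub 4 n N) => minAct 4 (sfClass 4 L N ε) L N (j + 1) (chart (ContinuousLinearMap.id ℝ (Matrix n n ℂ)) N V₀ (y : TDir 4 n N))) 0 := by
  obtain ⟨ε₀, hε₀, H⟩ := minimiser_contDiffAt_allData (n := n) hL
  refine ⟨ε₀, hε₀, fun ε hε hεle N _ hN j => ?_⟩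
  obtain ⟨δV, hδV, hall⟩ := H ε hε hεle N hN j
  refine ⟨δV, hδV, fun V₀ hV₀ => ?_⟩
  obtain ⟨⟨Us, hUs⟩, hsec⟩ := hall V₀ hV₀
  obtain ⟨-, -, -, -, h⟩ := hsec Us hUs
  exact h

end

end Summit.QuantumFields.BalabanUV.T4Continuum.NE7MinimiserC1AllData
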